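import Literature.Computability.QuantumComplexity.LocalOnPrograms
import Literature.Computability.QuantumComplexity.SandwichCircuit
import HarnessLib

/-!
# Wires of a flag-guarded program; locality of the active slot; invariance of the reachable labels

Topic `Literature/Computability/QuantumComplexity`; sequel of `GuardedOps.lean` (`guardOps`), `LocalOnPrograms.lean`
(`localOn_clEval_of_wires_off`, `localOn_clEval_guardOps_of_flags_off`) and `RevTableau.lean` (`wiresOf`).
Three bookkeeping facts for the idle-wire analysis of a universal machine with flag-guarded slots
(Regev's one-copy sampler, J. ACM 56 (2009), Lemma 3.14):

* `mem_wiresOf_guardBy`, **`mem_wiresOf_guardOps`** — the guarded program touches only the program's wires, the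
  flag and the scratch wire; `target_guardOps` — its targets are the program's targets or the scratch wire;
* **`localOn_clEval_guardOps_of_wires_off`** — hence the ACTIVE slot's guarded program (all of whose wires, flag
  and scratch lie off the idle set `T`) is local on every label set determined off `T` (operator level, no
  semantics needed), complementing `localOn_clEval_guardOps_of_flags_off` for the inactive slots;
* **`clEval_mem_iff_of_targets_off`** — a program that never targets the DETERMINING wires `D` of a label set
  `G` (input zone, flags) preserves membership in `G` (the `hG₁` hypothesis of `LocalOn.comp` /
  `IsBasisMap.mulVec_supportedIn`).

Everything is proved; no definition, no named fact is introduced.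

## References

* M. A. Nielsen, I. L. Chuang, *Quantum Computation and Quantum Information*, CUP 2010, §3.2.5, §4.3
  [NielsenChuang2010].
* O. Regev, *On lattices, learning with errors, random linear codes, and cryptography*, J. ACM 56 (2009),
  art. 34, Lemma 3.14 (proof) [Regev2009].
-/

namespace Literature.Computability.QuantumComplexity

open Cryptography RevSim

variable {ι : Type*}

/-- **Wires of one guarded operation**: the operation's wires, the flag, or the scratch wire. [cite: NielsenChuang2010, §4.3] -/
theorem mem_wiresOf_guardBy {flag s : ι} {op op' : ClOp ι} (hop' : op' ∈ op.guardBy flag s) {x : ι}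
    (hx : x ∈ wiresOf op') : x = flag ∨ x = s ∨ x ∈ wiresOf op := by
  rw [mem_wiresOf]
  rw [mem_wiresOf] at hx
  cases op with
  | not i =>
    simp only [ClOp.guardBy, List.mem_singleton] at hop'
    subst hop'
    simp only [ClOp.target, ClOp.controls, List.mem_singleton, List.not_mem_nil, or_false] at hx ⊢
    rcases hx with rfl | rfl
    · exact Or.inr (Or.inr rfl)
    · exact Or.inl rfl
  | cnot i j =>
    simp only [ClOp.guardBy, List.mem_singleton] at hop'
    subst hop'
    simp only [ClOp.target, ClOp.controls, List.mem_cons, List.not_mem_nil, or_false] at hx ⊢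
    rcases hx with rfl | rfl | rfl
    · exact Or.inr (Or.inr (Or.inl rfl))
    · exact Or.inl rfl
    · exact Or.inr (Or.inr (Or.inr rfl))
  | toffoli a b c =>
    simp only [ClOp.guardBy, List.mem_cons, List.not_mem_nil, or_false] at hop'
    simp only [ClOp.target, ClOp.controls, List.mem_cons, List.not_mem_nil, or_false]
    rcases hop' with rfl | rfl | rfl <;>
      simp only [ClOp.target, ClOp.controls, List.mem_cons, List.not_mem_nil, or_false] at hx
    · rcases hx with rfl | rfl | rfl
      · exact Or.inr (Or.inl rfl)
      · exact Or.inl rfl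
      · exact Or.inr (Or.inr (Or.inr (Or.inl rfl)))
    · rcases hx with rfl | rfl | rfl
      · exact Or.inr (Or.inr (Or.inl rfl))
      · exact Or.inr (Or.inl rfl)
      · exact Or.inr (Or.inr (Or.inr (Or.inr rfl)))
    · rcases hx with rfl | rfl | rfl
      · exact Or.inr (Or.inl rfl)
      · exact Or.inl rfl
      · exact Or.inr (Or.inr (Or.inr (Or.inl rfl)))

/-- **Wires of a guarded program**: the program's wires, the flag, or the scratch wire. [cite: NielsenChuang2010, §4.3] -/
theorem mem_wiresOf_guardOps {flag s : ι} {ops : List (ClOp ι)} {op' : ClOp ι} (hop' : op' ∈ guardOps flag s ops)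
    {x : ι} (hx : x ∈ wiresOf op') : x = flag ∨ x = s ∨ ∃ op ∈ ops, x ∈ wiresOf op := by
  rw [guardOps, List.mem_flatMap] at hop'
  obtain ⟨op, hop, hop'⟩ := hop'
  rcases mem_wiresOf_guardBy hop' hx with h | h | h
  · exact Or.inl h
  · exact Or.inr (Or.inl h)
  · exact Or.inr (Or.inr ⟨op, hop, h⟩)

/-- **Targets of a guarded program**: the program's targets or the scratch wire. [cite: NielsenChuang2010, §4.3] -/
theorem target_guardOps {flag s : ι} {ops : List (ClOp ι)} {op' : ClOp ι} (hop' : op' ∈ guardOps flag s ops) :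
    op'.target = s ∨ ∃ op ∈ ops, op'.target = op.target := by
  rw [guardOps, List.mem_flatMap] at hop'
  obtain ⟨op, hop, hop'⟩ := hop'
  cases op with
  | not i =>
    simp only [ClOp.guardBy, List.mem_singleton] at hop'
    subst hop'
    exact Or.inr ⟨_, hop, rfl⟩
  | cnot i j =>
    simp only [ClOp.guardBy, List.mem_singleton] at hop'
    subst hop'
    exact Or.inr ⟨_, hop, rfl⟩
  | toffoli a b c =>
    simp only [ClOp.guardBy, List.mem_cons, List.not_mem_nil, or_false] at hop'
    rcases hop' with rfl | rfl | rfl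
    · exact Or.inl rfl
    · exact Or.inr ⟨_, hop, rfl⟩
    · exact Or.inl rfl

/-! ### Consequences on a `W`-wire register -/

variable {W : ℕ} {T : Finset (Fin W)} {G : Set (QReg W)}

/-- **The active slot's guarded program is local** (operator level): all its wires, the flag and the scratch lie
off the idle set. [cite: NielsenChuang2010, §4.3] [cite: Regev2009, Lemma 3.14 (proof)] -/
theorem localOn_clEval_guardOps_of_wires_off (flag s : Fin W) (ops : List (ClOp (Fin W))) (hfl : flag ∉ T) (hs : s ∉ T)
    (hops : ∀ op ∈ ops, ∀ x ∈ wiresOf op, x ∉ T)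
    (hG : ∀ z z' : QReg W, (∀ w, w ∉ T → z w = z' w) → z ∈ G → z' ∈ G) :
    LocalOn (clEval (guardOps flag s ops)) T G := by
  refine localOn_clEval_of_wires_off _ (fun op' hop' => ⟨fun h => ?_, fun c hc h => ?_⟩) hG
  · rcases mem_wiresOf_guardOps hop' ((mem_wiresOf _ _).2 (Or.inl rfl)) with h' | h' | ⟨op, hop, h'⟩
    · exact hfl (h' ▸ h)
    · exact hs (h' ▸ h)
    · exact hops op hop _ h' h
  · rcases mem_wiresOf_guardOps hop' ((mem_wiresOf _ _).2 (Or.inr hc)) with h' | h' | ⟨op, hop, h'⟩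
    · exact hfl (h' ▸ h)
    · exact hs (h' ▸ h)
    · exact hops op hop _ h' h

/-- **A program that never targets the determining wires of `G` preserves membership in `G`.**
[cite: NielsenChuang2010, §3.2.5] -/
theorem clEval_mem_iff_of_targets_off (ops : List (ClOp (Fin W))) {D : Set (Fin W)} (hD : ∀ op ∈ ops, op.target ∉ D)
    (hG : ∀ z z' : QReg W, (∀ w ∈ D, z w = z' w) → (z ∈ G ↔ z' ∈ G)) (z : QReg W) : clEval ops z ∈ G ↔ z ∈ G :=
  hG _ _ fun _ hw => clEval_apply_of_forall_target_ne ops z fun op hop h => hD op hop (h ▸ hw)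

/-- The same for a guarded program whose scratch wire and program targets lie off `D`. [cite: NielsenChuang2010, §4.3] -/
theorem clEval_guardOps_mem_iff_of_targets_off (flag s : Fin W) (ops : List (ClOp (Fin W))) {D : Set (Fin W)}
    (hs : s ∉ D) (hD : ∀ op ∈ ops, op.target ∉ D)
    (hG : ∀ z z' : QReg W, (∀ w ∈ D, z w = z' w) → (z ∈ G ↔ z' ∈ G)) (z : QReg W) :
    clEval (guardOps flag s ops) z ∈ G ↔ z ∈ G :=
  clEval_mem_iff_of_targets_off _ (fun op' hop' h => by
    rcases target_guardOps hop' with h' | ⟨op, hop, h'⟩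
    · exact hs (h' ▸ h)
    · exact hD op hop (h' ▸ h)) hG z

end Literature.Computability.QuantumComplexity
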